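import Summits.QuantumFields.BalabanUV.T4Continuum.Support.B13TermDataRefAt
import Summits.QuantumFields.BalabanUV.T4Continuum.Support.B13StepOfRecordSecantTermwise

/-!
# NE5 ∕ U3 — term-format slots, part 4: route P2's ACTIVITY-LEVEL OPERATOR BINDERS `ActOpBound` ∕ `ActOpLip` (the operator half of W2
# relocated to the (2.14)-terms, `B13TermOpSecant` p212487) READ OFF the SAME one-run reference data `RefAt` + P2's per-term tilt lemma
# `ActivityTermSlot.norm_term_sub_le`, for the `act` slot of the model of record in term format (row O1-d2 follower; parts 1–3 =
# `B13TermData` p212301, `B13StepOfRecordTermData` p212552, `B13TermDataRefAt`)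

Cell `pub-balaban`, unit `b2b-balaban-t4-ne5-formalise-leaf-08` (NE5 formalisation swarm, LEAF PROVER 08, gen 2; row O1-d2 holder).  Summits-side
bookkeeping under the LEAN PLACEMENT RULE (NOT a Literature module).  HONEST FRAMING: rung (B)+1 of the FINITE-VOLUME T⁴ continuum programme —
NOT infinite volume, NOT a mass gap, NOT the Clay problem, NOT a proof of NE5 (NOT PRINTED; cell GAPS G-t4-U3-1) and NOT a proof of the
output-level wall W2-op (GAPS G-ne5p1-1′): route P2's `norm_term_sub_le` is a theorem about ITS TERM MODEL from DISPLAYED one-run data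
(`RefAt`, `Geometry`, `ReadLip`, `Admissible` — printed KIND (2.15)–(2.26) pp. 15–18 of [Balaban1988RG2Cluster], locators only); for Bałaban's
actual kernels those data stay displayed.  HONEST DEPENDENCY (cell line, verbatim): continuum YM on T⁴ ⇐ BetaPertH ∧ nine spine estimates (0/9
proved); BetaPertH ⇐ (D1) ∧ (D4) ∧ CAP+tail; G-an2-4 gates asym, D1 and NE2/3/4.

WHAT.  `B13TermOpSecant.opLipschitz_record_of_actOpLip` (P2 g18) produces the secant END's `hopL : OpLipschitz (step S E₀ cB) W κ G₁ ρ₀` from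
two displayed TERMWISE binders on the operator ball around the base points — `ActOpBound … A` and `ActOpLip … N A` — plus d3's convergence and a
first-moment budget.  For the term-format slots `𝔖.toSlots` (`act := actOf (termData F G rHist core)`) each activity term IS `(termData …).term`,
so P2's per-term tilt lemma applies:
* §1 one term (any `TermDatum`): `norm_term_opDisplaced_sub_le` — `‖term (o, pt.2) − term pt‖ ≤ ampOp 𝔠 0 · (‖o − pt.1‖∕ϱOp)` within
  operator reach `≤ 1` at FIXED history (P2's `norm_term_sub_le` with history displacement `0`); `norm_term_opDisplaced_le` —
  `‖term (o, pt.2)‖ ≤ size + ampOp 𝔠 0` there (triangle + P2's `norm_term_le`).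
* §2 on the model of record, under the section binders `hadm` (admissible constants), `hgeo` (P2's one-run `Geometry` per term datum),
  `hlip` (P2's `ReadLip (𝔡 Z ℓ) (rOp (scale Z)) (rHist (scale Z))` per term — for the B13 format `F k = (G k).format` this is part 1's
  `readLip_toTermDatum`, i.e. format inequalities only; kept displayed so that fork F1 stays untouched), `hRefBase` (`RefAt (𝔡 Z ℓ) p` at every
  BASE point `p ∈ (step …).Base k g U` for every factor of every tuple localizing at a step-`k` domain) and reach `0 ≤ ρ₀ ≤ 1`:
  **`actOpBound_toSlots_of_refAt`** and **`actOpLip_toSlots_of_refAt`** with `A := fun _ _ _ Z ℓ => (𝔡 Z ℓ).size + ampOp (termData … Z ℓ) (𝔡 Z ℓ) 0`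
  and relative modulus `N := 1`; hence **`opLipschitz_toSlots_of_refAt`** = P2's `opLipschitz_record_of_actOpLip` with `habs`∕`hlip`∕`hA0`∕`hN0`
  DISCHARGED — `OpLipschitz (step 𝔖.toSlots E₀ cB) W κ G₁ ρ₀` modulo d3's convergence for `A` and the first-moment budget `G₁` for `(1, A)`
  (displayed; the anchored-norm route to them is leaf-03∕01's, BY NAME, not repeated).
* §3 **`ne5_of_record_secant_termData_termwise`** — leaf-01's E8[rec] with both halves at activity level (`B13StepOfRecordSecantTermwise`,
  p213235) at `S := 𝔖.toSlots` with ALL FIVE activity-level W2 binders (`hopB`, `hopL`, `hexp`, `hN`, `habs`) and their sign binders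
  DISCHARGED by parts 1–4; conclusion literally `NE5 (outA 𝔖.toSlots E₀ cB) (outB 𝔖.toSlots E₀ cB) W ϰ θ′ C₅`.
CENSUS (with parts 2–3): for term-format slots BOTH halves of W2 in the secant END of record read route P2's per-term one-run data
(`Admissible`, `Geometry`, `ReadLip`, `RefAt` at base∕class points) + (2.38)-KIND budgets of the per-term numbers `size`, `size + ampOp 0`, `N̄`;
the END's other binders are unchanged.  Nothing of [II] asserted; no END module edited.  0 sorry; axioms ⊆ {propext, Classical.choice, Quot.sound}.
-/

noncomputable section

open MeasureTheory
open scoped BigOperators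

namespace Summit.QuantumFields.BalabanUV.T4Continuum.B13TermDataOpSecant

open Literature.MathematicalPhysics.QuantumFieldTheory.Balaban1983to89
open Literature.MathematicalPhysics.QuantumFieldTheory.Balaban1983to89.T4OutputRate (Carriers DecayBound NE5)
open Literature.MathematicalPhysics.QuantumFieldTheory.Balaban1983to89.T4InputCauchyRateData (StepModel)
open Literature.MathematicalPhysics.QuantumFieldTheory.Balaban1983to89.T4InputCauchyRateSpecies (ballClass OpLipschitz)
open Summit.QuantumFields.BalabanUV.T4Continuum.ActivityTermModel (TermDatum TermConsts)
open Summit.QuantumFields.BalabanUV.T4Continuum.B13OpDatum (Format OpDatum Species B13Weights)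
open Summit.QuantumFields.BalabanUV.T4Continuum.B13HistDatum (level136)
open Summit.QuantumFields.BalabanUV.T4Continuum.B13HistMeasurable (MeasPotFrame B13HistM)
open Summit.QuantumFields.BalabanUV.T4Continuum.B13StepTermFamily (TermIndexing)
open Summit.QuantumFields.BalabanUV.T4Continuum.B13StepTermExpLinear (actOf)
open Summit.QuantumFields.BalabanUV.T4Continuum.B13TermRep (actMajorant)
open Summit.QuantumFields.BalabanUV.T4Continuum.B13TermHistSecant (secMajorant)
open Summit.QuantumFields.BalabanUV.T4Continuum.B13TermOpSecant (ActOpBound ActOpLip opLipschitz_b13_of_actOpLip)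
open Summit.QuantumFields.BalabanUV.T4Continuum.B13Carriers (TwoRuns)
open Summit.QuantumFields.BalabanUV.T4Continuum.B13StepTermLabels (TermIdx InnerLabel)
open Summit.QuantumFields.BalabanUV.T4Continuum.B13StepTermSocket (labelsIndexing touchInc)
open Summit.QuantumFields.BalabanUV.T4Continuum.B13InnerData (Bnd b13InnerData)
open Summit.QuantumFields.BalabanUV.T4Continuum.B13OpDatumJunctions (RawBounded WeightedEntrywiseRate)
open Summit.QuantumFields.BalabanUV.T4Continuum.B13Base (selfCtr)
open Summit.QuantumFields.BalabanUV.T4Continuum.UrsellTermBudget (actSum)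
open Summit.QuantumFields.BalabanUV.T4Continuum.B13StepOfRecord (Slots assembly step outA outB)
open Summit.QuantumFields.BalabanUV.T4Continuum.B13StepOfRecordSecantTermwise (ne5_of_record_secant_termwise)
open Summit.QuantumFields.BalabanUV.T4Continuum.B13TermData (TermCore termData)
open Summit.QuantumFields.BalabanUV.T4Continuum.B13StepOfRecordTermData (TermSlots)
open Summit.QuantumFields.BalabanUV.T4Continuum.B13TermDataRefAt (size_nonneg refF_of_refAt invNorm_mul_integral_norm_F_le)
open Summit.QuantumFields.BalabanUV.T4Continuum.B13StepTermExpLinear (dataOf)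
open Summit.QuantumFields.BalabanUV.T4Continuum.B13TermData (histLs)

/-! ## §1 One term: operator displacement at fixed history (route P2's tilt lemma with history displacement `0`) -/

section OneTerm

variable {Op Hist ι κ S Ω Ω₀ 𝒴 𝒞 : Type*} [Fintype ι] [Fintype κ] [DecidableEq ι] [DecidableEq κ] [DecidableEq 𝒞] [MeasurableSpace Ω]
  [MeasurableSpace Ω₀] [NormedAddCommGroup Op] [NormedAddCommGroup Hist] (𝔱 : TermDatum Op Hist ι κ S Ω Ω₀ 𝒴 𝒞) {𝔠 : TermConsts}
  {ϱOp ϱHist : ℝ}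

/-- [folklore] **OPERATOR DISPLACEMENT AT FIXED HISTORY**: within operator reach `‖o − pt.1‖∕ϱOp ≤ 1` of a point carrying reference data,
`‖term (o, pt.2) − term pt‖ ≤ ampOp 𝔠 0 · (‖o − pt.1‖∕ϱOp)` — P2's `norm_term_sub_le` at `qt := (o, pt.2)` (history displacement `0`, so the
history reach parameter may be taken `0`). -/
theorem norm_term_opDisplaced_sub_le (hϱOp : 0 < ϱOp) (hϱHist : 0 < ϱHist) (hadm : 𝔠.Admissible) (hgeo : 𝔱.Geometry 𝔠)
    (hlip : 𝔱.ReadLip 𝔠 ϱOp ϱHist) {pt : Op × Hist} (href : 𝔱.RefAt 𝔠 pt) (o : Op) (ht1 : ‖o - pt.1‖ / ϱOp ≤ 1) :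
    ‖𝔱.term (o, pt.2) - 𝔱.term pt‖ ≤ 𝔱.ampOp 𝔠 0 * (‖o - pt.1‖ / ϱOp) := by
  have h := 𝔱.norm_term_sub_le 𝔠 hϱOp hϱHist hadm hgeo hlip href (o, pt.2) ht1
    (by rw [sub_self, norm_zero, zero_div] : ‖(o, pt.2).2 - pt.2‖ / ϱHist ≤ 0)
  simpa using h

/-- [folklore] **THE TERM ON THE OPERATOR BALL**: `‖term (o, pt.2)‖ ≤ size + ampOp 𝔠 0` within operator reach `≤ 1` of a point carrying
reference data (triangle inequality + P2's `norm_term_le` + §1's displacement bound, `ampOp ≥ 0`). -/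
theorem norm_term_opDisplaced_le (hϱOp : 0 < ϱOp) (hϱHist : 0 < ϱHist) (hadm : 𝔠.Admissible) (hgeo : 𝔱.Geometry 𝔠)
    (hlip : 𝔱.ReadLip 𝔠 ϱOp ϱHist) {pt : Op × Hist} (href : 𝔱.RefAt 𝔠 pt) (o : Op) (ht1 : ‖o - pt.1‖ / ϱOp ≤ 1) :
    ‖𝔱.term (o, pt.2)‖ ≤ 𝔠.size + 𝔱.ampOp 𝔠 0 := by
  have hamp : 0 ≤ 𝔱.ampOp 𝔠 0 := (𝔱.amp_nonneg 𝔠 hadm 0).1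
  have hdiff := norm_term_opDisplaced_sub_le 𝔱 hϱOp hϱHist hadm hgeo hlip href o ht1
  have hbase := 𝔱.norm_term_le 𝔠 hadm href
  calc ‖𝔱.term (o, pt.2)‖ = ‖𝔱.term pt + (𝔱.term (o, pt.2) - 𝔱.term pt)‖ := by rw [add_sub_cancel]
    _ ≤ ‖𝔱.term pt‖ + ‖𝔱.term (o, pt.2) - 𝔱.term pt‖ := norm_add_le _ _
    _ ≤ 𝔠.size + 𝔱.ampOp 𝔠 0 * (‖o - pt.1‖ / ϱOp) := add_le_add hbase hdiff
    _ ≤ 𝔠.size + 𝔱.ampOp 𝔠 0 * 1 := by gcongr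
    _ = 𝔠.size + 𝔱.ampOp 𝔠 0 := by rw [mul_one]

end OneTerm

/-! ## §2 On the model of record: `ActOpBound` ∕ `ActOpLip` for term-format slots from the per-term one-run data -/

section OfRecord

variable {𝔾 : Type} [GaugeGroup 𝔾] {R : TwoRuns 𝔾} {P : MeasPotFrame R.carriers} {𝒴 : Type*} {dom : 𝒴 → R.carriers.Dom}
  {T κ ι S Ω Ω₀ 𝒞 IOp : Type*} [MeasurableSpace Ω] [MeasurableSpace Ω₀] [Fintype ι] [Fintype κ] [DecidableEq ι] [DecidableEq κ]
  [DecidableEq 𝒞] (𝔖 : TermSlots R P dom T κ ι S Ω Ω₀ 𝒞 IOp) (𝔡 : R.carriers.Dom → InnerLabel R.carriers.Dom (Bnd R) → TermConsts)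
  (E₀ cB : ℝ) {W : Set (ℕ → ℝ)} {ρ₀ : ℝ}

/-- [folklore] On the indexing of record every factor of a tuple localizing at a step-`k` domain has scale `k` (leaf-02's well-formedness +
`DomainGeometry.mem_level`). -/
theorem scale_poly_of_rel {k : ℕ} {i : TermIdx R.carriers.Dom (Bnd R)} {X : R.carriers.Dom}
    (hi : (labelsIndexing (B13DomainGeometryTR.domainGeometry R) (b13InnerData R)).Rel k i X)
    (m : Fin ((labelsIndexing (B13DomainGeometryTR.domainGeometry R) (b13InnerData R)).len i + 1)) :
    R.carriers.scale ((labelsIndexing (B13DomainGeometryTR.domainGeometry R) (b13InnerData R)).poly i m) = k :=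
  ((B13DomainGeometryTR.domainGeometry R).mem_level _ _).1 (hi.2.1 m).1

omit [DecidableEq 𝒞] in
/-- [folklore] Within reach `ρ₀ ≤ 1` of a base point the relative operator displacement in the factor's own margin is `≤ 1`. -/
theorem rel_disp_le_one (hρ₀1 : ρ₀ ≤ 1) {k : ℕ} {p : OpDatum (Species T κ ι Ω 𝒴) × B13HistM P} {o : OpDatum (Species T κ ι Ω 𝒴)}
    (ho : ‖o - p.1‖ ≤ ρ₀ * (step 𝔖.toSlots E₀ cB).rOp k) {Z : R.carriers.Dom} (hZ : R.carriers.scale Z = k) :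
    ‖o - p.1‖ / 𝔖.rOp (R.carriers.scale Z) ≤ 1 := by
  rw [hZ, div_le_one (𝔖.rOp_pos k)]
  exact ho.trans (mul_le_of_le_one_left (𝔖.rOp_pos k).le hρ₀1)

omit [Fintype ι] [Fintype κ] [DecidableEq ι] [DecidableEq κ] [DecidableEq 𝒞] in
/-- [folklore] The majorant `size + ampOp 0` is nonnegative on the admissible range. -/
theorem opMajorant_nonneg (hadm : ∀ Z ℓ, (𝔡 Z ℓ).Admissible) (Z : R.carriers.Dom) (ℓ : InnerLabel R.carriers.Dom (Bnd R)) :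
    0 ≤ (𝔡 Z ℓ).size + (termData 𝔖.F 𝔖.G 𝔖.rHist 𝔖.core Z ℓ).ampOp (𝔡 Z ℓ) 0 :=
  add_nonneg (size_nonneg (hadm Z ℓ)) ((termData 𝔖.F 𝔖.G 𝔖.rHist 𝔖.core Z ℓ).amp_nonneg (𝔡 Z ℓ) (hadm Z ℓ) 0).1

/-! SECTION BINDERS (included below): admissible term constants `hadm`; route P2's one-run `Geometry` per term datum `hgeo`; its read-out
Lipschitz structure `hlip` in the margins of the term's OWN scale (for the B13 format this is part 1's `readLip_toTermDatum` — format
inequalities only; displayed here so that fork F1 stays untouched); `hRefBase` — `RefAt (𝔡 Z ℓ) p` at every BASE point for every factor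
of every tuple localizing at a step-`k` domain (printed KIND (2.15)–(2.26), locator only); reach `ρ₀ ≤ 1`. -/
variable (hadm : ∀ Z ℓ, (𝔡 Z ℓ).Admissible)
  (hgeo : ∀ Z ℓ, (termData 𝔖.F 𝔖.G 𝔖.rHist 𝔖.core Z ℓ).Geometry (𝔡 Z ℓ))
  (hlip : ∀ Z ℓ, (termData 𝔖.F 𝔖.G 𝔖.rHist 𝔖.core Z ℓ).ReadLip (𝔡 Z ℓ) (𝔖.rOp (R.carriers.scale Z)) (𝔖.rHist (R.carriers.scale Z)))
  (hRefBase : ∀ k, ∀ g ∈ W, ∀ (U : R.carriers.BgB) (p : OpDatum (Species T κ ι Ω 𝒴) × B13HistM P),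
    p ∈ (step 𝔖.toSlots E₀ cB).Base k g U → ∀ X : R.carriers.Dom, R.carriers.scale X = k →
      ∀ i : TermIdx R.carriers.Dom (Bnd R), (labelsIndexing (B13DomainGeometryTR.domainGeometry R) (b13InnerData R)).Rel k i X →
        ∀ m, (termData 𝔖.F 𝔖.G 𝔖.rHist 𝔖.core
            ((labelsIndexing (B13DomainGeometryTR.domainGeometry R) (b13InnerData R)).poly i m)
            ((labelsIndexing (B13DomainGeometryTR.domainGeometry R) (b13InnerData R)).lab i m)).RefAt
          (𝔡 ((labelsIndexing (B13DomainGeometryTR.domainGeometry R) (b13InnerData R)).poly i m)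
            ((labelsIndexing (B13DomainGeometryTR.domainGeometry R) (b13InnerData R)).lab i m)) p)
  (hρ₀1 : ρ₀ ≤ 1)
include hadm hgeo hlip hRefBase hρ₀1

/-- [folklore] **`ActOpBound` FOR TERM-FORMAT SLOTS**: on the operator ball of reach `ρ₀ ≤ 1` around every base point, every factor's activity
term is bounded by `size + ampOp 0` of its own term datum (§1 + `hRefBase`). -/
theorem actOpBound_toSlots_of_refAt :
    ActOpBound (labelsIndexing (B13DomainGeometryTR.domainGeometry R) (b13InnerData R)) 𝔖.toSlots.act (step 𝔖.toSlots E₀ cB) W ρ₀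
      (fun _ _ _ Z ℓ => (𝔡 Z ℓ).size + (termData 𝔖.F 𝔖.G 𝔖.rHist 𝔖.core Z ℓ).ampOp (𝔡 Z ℓ) 0) := by
  intro k g hg U p hp o ho X hX i hi m
  have hZ := scale_poly_of_rel hi m
  exact norm_term_opDisplaced_le (termData 𝔖.F 𝔖.G 𝔖.rHist 𝔖.core _ _) (𝔖.rOp_pos _) (𝔖.rHist_pos _) (hadm _ _) (hgeo _ _)
    (hlip _ _) (hRefBase k g hg U p hp X hX i hi m) o (rel_disp_le_one 𝔖 E₀ cB hρ₀1 ho hZ)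

/-- [folklore] **`ActOpLip` FOR TERM-FORMAT SLOTS** with relative modulus `N := 1` against the same `A := size + ampOp 0`: moving the operator
datum from a base point within reach moves each factor by `≤ ampOp 0 · (‖o − p.1‖∕rOp k) ≤ 1·(‖o − p.1‖∕rOp k)·(size + ampOp 0)` (§1). -/
theorem actOpLip_toSlots_of_refAt :
    ActOpLip (labelsIndexing (B13DomainGeometryTR.domainGeometry R) (b13InnerData R)) 𝔖.toSlots.act (step 𝔖.toSlots E₀ cB) W ρ₀
      (fun _ _ _ _ _ => 1) (fun _ _ _ Z ℓ => (𝔡 Z ℓ).size + (termData 𝔖.F 𝔖.G 𝔖.rHist 𝔖.core Z ℓ).ampOp (𝔡 Z ℓ) 0) := by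
  intro k g hg U p hp o ho X hX i hi m
  have hZ := scale_poly_of_rel hi m
  have hr : 0 ≤ ‖o - p.1‖ / (step 𝔖.toSlots E₀ cB).rOp k := div_nonneg (norm_nonneg _) (𝔖.rOp_pos k).le
  have hdiff := norm_term_opDisplaced_sub_le (termData 𝔖.F 𝔖.G 𝔖.rHist 𝔖.core _ _) (𝔖.rOp_pos _) (𝔖.rHist_pos _) (hadm _ _)
    (hgeo _ _) (hlip _ _) (hRefBase k g hg U p hp X hX i hi m) o (rel_disp_le_one 𝔖 E₀ cB hρ₀1 ho hZ)
  rw [hZ] at hdiff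
  have hsize : 0 ≤ (𝔡 ((labelsIndexing (B13DomainGeometryTR.domainGeometry R) (b13InnerData R)).poly i m)
      ((labelsIndexing (B13DomainGeometryTR.domainGeometry R) (b13InnerData R)).lab i m)).size := size_nonneg (hadm _ _)
  have hamp : 0 ≤ (termData 𝔖.F 𝔖.G 𝔖.rHist 𝔖.core
      ((labelsIndexing (B13DomainGeometryTR.domainGeometry R) (b13InnerData R)).poly i m)
      ((labelsIndexing (B13DomainGeometryTR.domainGeometry R) (b13InnerData R)).lab i m)).ampOp
      (𝔡 ((labelsIndexing (B13DomainGeometryTR.domainGeometry R) (b13InnerData R)).poly i m)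
        ((labelsIndexing (B13DomainGeometryTR.domainGeometry R) (b13InnerData R)).lab i m)) 0 :=
    ((termData 𝔖.F 𝔖.G 𝔖.rHist 𝔖.core _ _).amp_nonneg _ (hadm _ _) 0).1
  refine hdiff.trans ?_
  rw [one_mul, mul_comm]
  exact mul_le_mul_of_nonneg_left (le_add_of_nonneg_left hsize) hr

/-- [folklore] **W2-op FOR TERM-FORMAT SLOTS, ON THE MODEL OF RECORD** — P2's `opLipschitz_b13_of_actOpLip` (p212487) at `M := step 𝔖.toSlots E₀ cB`
(`hM := rfl`) with `habs`, `hlip`, `hA0`, `hN0` DISCHARGED by §2: `OpLipschitz (step 𝔖.toSlots E₀ cB) W ϰ G₁ ρ₀` — literally the `hopL` binder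
of the secant END of record — from the per-term one-run data (section binders), `0 ≤ ρ₀`, d3's convergence for `A := size + ampOp 0` and the
per-domain first-moment budget `G₁` for `(1, A)` (displayed; (2.38)-KIND, produced from the anchored norm elsewhere BY NAME).  NOT a proof of
W2-op for Bałaban's kernels; the NE5 rate is spelled `ϰ` (`κ` is the bond-site type). -/
theorem opLipschitz_toSlots_of_refAt (hρ₀ : 0 ≤ ρ₀) {ϰ G₁ : ℝ}
    (hconv : ∀ k, ∀ g ∈ W, ∀ (U : R.carriers.BgB) (X : R.carriers.Dom), R.carriers.scale X = k →
      Summable (actMajorant (labelsIndexing (B13DomainGeometryTR.domainGeometry R) (b13InnerData R))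
        (touchInc (B13DomainGeometryTR.domainGeometry R))
        (fun Z ℓ => (𝔡 Z ℓ).size + (termData 𝔖.F 𝔖.G 𝔖.rHist 𝔖.core Z ℓ).ampOp (𝔡 Z ℓ) 0) k X))
    (hmom : ∀ k, ∀ g ∈ W, ∀ (U : R.carriers.BgB) (X : R.carriers.Dom), R.carriers.scale X = k →
      Summable (secMajorant (labelsIndexing (B13DomainGeometryTR.domainGeometry R) (b13InnerData R))
        (touchInc (B13DomainGeometryTR.domainGeometry R)) (fun _ _ => (1 : ℝ))
        (fun Z ℓ => (𝔡 Z ℓ).size + (termData 𝔖.F 𝔖.G 𝔖.rHist 𝔖.core Z ℓ).ampOp (𝔡 Z ℓ) 0) k X) ∧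
        ∑' i, secMajorant (labelsIndexing (B13DomainGeometryTR.domainGeometry R) (b13InnerData R))
          (touchInc (B13DomainGeometryTR.domainGeometry R)) (fun _ _ => (1 : ℝ))
          (fun Z ℓ => (𝔡 Z ℓ).size + (termData 𝔖.F 𝔖.G 𝔖.rHist 𝔖.core Z ℓ).ampOp (𝔡 Z ℓ) 0) k X i ≤
          G₁ * Real.exp (-(ϰ * R.carriers.d X))) :
    OpLipschitz (step 𝔖.toSlots E₀ cB) W ϰ G₁ ρ₀ :=
  opLipschitz_b13_of_actOpLip (M := step 𝔖.toSlots E₀ cB) (fun _ _ _ _ => rfl) hρ₀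
    (fun _ _ _ Z ℓ => opMajorant_nonneg 𝔖 𝔡 hadm Z ℓ) (fun _ _ _ _ _ => zero_le_one)
    (actOpBound_toSlots_of_refAt 𝔖 𝔡 E₀ cB hadm hgeo hlip hRefBase hρ₀1)
    (actOpLip_toSlots_of_refAt 𝔖 𝔡 E₀ cB hadm hgeo hlip hRefBase hρ₀1)
    (fun k g hg U X hX => hconv k g hg U X hX) fun k g hg U X hX => hmom k g hg U X hX

end OfRecord

/-! ## §3 E8[rec] for term-format slots: leaf-01's termwise secant END with ALL FIVE activity-level W2 binders read off the per-term data -/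

section End

variable {𝔾 : Type} [GaugeGroup 𝔾] {R : TwoRuns 𝔾} {P : MeasPotFrame R.carriers} {𝒴 : Type*} {dom : 𝒴 → R.carriers.Dom}
  {T κ ι S Ω Ω₀ 𝒞 IOp : Type*} [MeasurableSpace Ω] [MeasurableSpace Ω₀] [Fintype ι] [Fintype κ] [DecidableEq ι] [DecidableEq κ]
  [DecidableEq 𝒞] [NormedAddCommGroup IOp] [NormedSpace ℂ IOp] (𝔖 : TermSlots R P dom T κ ι S Ω Ω₀ 𝒞 IOp)
  (𝔡 : R.carriers.Dom → InnerLabel R.carriers.Dom (Bnd R) → TermConsts) (E₀ cB : ℝ)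

/-- [folklore] **E8[rec] FOR TERM-FORMAT SLOTS — EVERY ACTIVITY-LEVEL W2 BINDER READ OFF ROUTE P2's PER-TERM ONE-RUN DATA.**  leaf-01's
`B13StepOfRecordSecantTermwise.ne5_of_record_secant_termwise` (p213235) at `S := 𝔖.toSlots` with `hopB := actOpBound_toSlots_of_refAt`,
`hopL := actOpLip_toSlots_of_refAt` (`Nop := 1`, `Aop := size + ampOp 0`), `hexp`∕`hN`∕`habs` := parts 1–3 (`A := size`), and the sign binders
`hNop0 hNople hNopbar hAop0 hA0 hN0` PROVED.  DISPLAYED about the cores, and nothing else of W2: admissible constants `𝔡`, route P2's `Geometry`,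
`ReadLip` (own-scale margins), `RefAt` at the BASE points and at the points of the budget ball class (printed KIND (2.15)–(2.26), locators only),
reach `ρ₀ ≤ 1`, the per-term number bound `N̄ ≥ rHist k·Σ_{Y∈𝐃(Z ℓ)}‖τ Y‖·level136`, and the (2.38)-SHAPED decay∕level-sum budgets of the two
per-term numbers `size` (history side: `A′`, `ε`) and `size + ampOp 0` (operator side: `Aop′`, `εop`) with the rate room `Rt` and `36Φ < 1`;
every other binder (reading, slice budgets, L05∕L06, W1 entry data, insertion-operator species, radii, signs, numerics) is leaf-01's verbatim.
Conclusion LITERALLY `NE5 (outA 𝔖.toSlots E₀ cB) (outB 𝔖.toSlots E₀ cB) W ϰ θ′ C₅` with leaf-01's constant at `N̄op := 1`.  NOT a proof of NE5. -/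
theorem ne5_of_record_secant_termData_termwise {W : Set (ℕ → ℝ)} {ROp RHist : ℕ → ℝ}
    {A' Aop' : ℕ → (ℕ → ℝ) → R.carriers.BgB → R.carriers.Dom → InnerLabel R.carriers.Dom (Bnd R) → ℝ}
    {ϰ Nbar ε εop Rt EA₀ E₁ cA c₁ r₀ Gi δI ρ₁ θ θ' ρ₀ B : ℝ} {k₀ k₁ : ℕ} (rI : ℕ → ℝ) (hrI : ∀ k, 0 < rI k)
    -- the per-term one-run data (route P2's shapes) and the reach
    (hadm : ∀ Z ℓ, (𝔡 Z ℓ).Admissible)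
    (hgeo : ∀ Z ℓ, (termData 𝔖.F 𝔖.G 𝔖.rHist 𝔖.core Z ℓ).Geometry (𝔡 Z ℓ))
    (hlip : ∀ Z ℓ, (termData 𝔖.F 𝔖.G 𝔖.rHist 𝔖.core Z ℓ).ReadLip (𝔡 Z ℓ) (𝔖.rOp (R.carriers.scale Z)) (𝔖.rHist (R.carriers.scale Z)))
    (hRefBase : ∀ k, ∀ g ∈ W, ∀ (U : R.carriers.BgB) (p : OpDatum (Species T κ ι Ω 𝒴) × B13HistM P),
      p ∈ (step 𝔖.toSlots E₀ cB).Base k g U → ∀ X : R.carriers.Dom, R.carriers.scale X = k →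
        ∀ i : TermIdx R.carriers.Dom (Bnd R), (labelsIndexing (B13DomainGeometryTR.domainGeometry R) (b13InnerData R)).Rel k i X →
          ∀ m, (termData 𝔖.F 𝔖.G 𝔖.rHist 𝔖.core
              ((labelsIndexing (B13DomainGeometryTR.domainGeometry R) (b13InnerData R)).poly i m)
              ((labelsIndexing (B13DomainGeometryTR.domainGeometry R) (b13InnerData R)).lab i m)).RefAt
            (𝔡 ((labelsIndexing (B13DomainGeometryTR.domainGeometry R) (b13InnerData R)).poly i m)
              ((labelsIndexing (B13DomainGeometryTR.domainGeometry R) (b13InnerData R)).lab i m)) p)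
    (hRef : ∀ k, ∀ g ∈ W, ∀ (U : R.carriers.BgB) (q : OpDatum (Species T κ ι Ω 𝒴) × B13HistM P),
      q ∈ ballClass (selfCtr (assembly 𝔖.toSlots).raw (assembly 𝔖.toSlots).histRef) ROp RHist k g U →
      ∀ X : R.carriers.Dom, R.carriers.scale X = k →
        ∀ i : TermIdx R.carriers.Dom (Bnd R), (labelsIndexing (B13DomainGeometryTR.domainGeometry R) (b13InnerData R)).Rel k i X →
          ∀ m, (termData 𝔖.F 𝔖.G 𝔖.rHist 𝔖.core
              ((labelsIndexing (B13DomainGeometryTR.domainGeometry R) (b13InnerData R)).poly i m)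
              ((labelsIndexing (B13DomainGeometryTR.domainGeometry R) (b13InnerData R)).lab i m)).RefAt
            (𝔡 ((labelsIndexing (B13DomainGeometryTR.domainGeometry R) (b13InnerData R)).poly i m)
              ((labelsIndexing (B13DomainGeometryTR.domainGeometry R) (b13InnerData R)).lab i m)) q)
    (hρ₀ : 0 ≤ ρ₀) (hρ₀1 : ρ₀ ≤ 1)
    -- leaf-01's non-W2 binders, verbatim
    (hT : (assembly 𝔖.toSlots).TransportReads W)
    (hbB : (assembly 𝔖.toSlots).SliceBudgetB W ϰ cB) (hbA : 𝔖.D.SliceBudget (step 𝔖.toSlots E₀ cB) W ϰ cA)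
    (hdA : DecayBound (outA 𝔖.toSlots E₀ cB) W EA₀ ϰ) (hdB : DecayBound (outB 𝔖.toSlots E₀ cB) W E₀ ϰ)
    (hRA : RawBounded 𝔖.F (assembly 𝔖.toSlots).rawAt W) (hRB : RawBounded 𝔖.F 𝔖.rawB W)
    (hwer : WeightedEntrywiseRate 𝔖.F (assembly 𝔖.toSlots).rawAt 𝔖.rawB W c₁ fun k => θ ^ k) (hfl : ∀ k, r₀ ≤ 𝔖.rOp k)
    (hienv : (𝔖.D.toInsOpModel (step 𝔖.toSlots E₀ cB) rI hrI).InsOpEnvelope W ϰ E₀ Gi)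
    (hibdA : (𝔖.D.toInsOpModel (step 𝔖.toSlots E₀ cB) rI hrI).InsBoundA W ϰ E₀ Gi)
    (hirate : (𝔖.D.toInsOpModel (step 𝔖.toSlots E₀ cB) rI hrI).InsOpRate W δI θ) (hδI : 0 ≤ δI) (hGi : 0 ≤ Gi) (hρ₁ : ρ₁ < 1)
    (hreachI : δI * θ ^ k₁ ≤ ρ₁)
    -- the (2.38)-shaped budgets of the two per-term numbers and the number bound
    (hAop0' : ∀ k g U Z ℓ, 0 ≤ Aop' k g U Z ℓ)
    (hdecop : ∀ k g U Z ℓ, (𝔡 Z ℓ).size + (termData 𝔖.F 𝔖.G 𝔖.rHist 𝔖.core Z ℓ).ampOp (𝔡 Z ℓ) 0 ≤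
      Aop' k g U Z ℓ * Real.exp (-(ϰ * (R.carriers.d Z + 5)))) (hεop : 0 ≤ εop)
    (h238op : ∀ k, ∀ g ∈ W, ∀ (U : R.carriers.BgB), ∀ Z ∈ R.domAt k,
      actSum (b13InnerData R) (Aop' k g U) k Z ≤ εop * Real.exp (-(Rt * R.carriers.d Z)))
    (hΦopsmall : 36 * (εop * Real.exp 64 * B12TreeDecay.K₀ (4 * 2 ^ 4) (2 * 4)) < 1)
    (hNbar0 : 0 ≤ Nbar)
    (hNle : ∀ k (Z : R.carriers.Dom) (ℓ : InnerLabel R.carriers.Dom (Bnd R)),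
      𝔖.rHist k * ∑ Y ∈ (𝔖.core Z ℓ).D, ‖(𝔖.G (R.carriers.scale Z)).τ Y‖ * level136 P.consts (R.carriers.d (dom Y)) ≤ Nbar)
    (hA0' : ∀ k g U Z ℓ, 0 ≤ A' k g U Z ℓ) (hϰ : 0 ≤ ϰ)
    (hdec : ∀ k g U Z ℓ, (𝔡 Z ℓ).size ≤ A' k g U Z ℓ * Real.exp (-(ϰ * (R.carriers.d Z + 5)))) (hε : 0 ≤ ε)
    (h238 : ∀ k, ∀ g ∈ W, ∀ (U : R.carriers.BgB), ∀ Z ∈ R.domAt k,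
      actSum (b13InnerData R) (A' k g U) k Z ≤ ε * Real.exp (-(Rt * R.carriers.d Z)))
    (hRt : 64 * Real.log 162 + 64 ≤ Rt) (hΦsmall : 36 * (ε * Real.exp 64 * B12TreeDecay.K₀ (4 * 2 ^ 4) (2 * 4)) < 1)
    -- radii, signs, numerics (leaf-01's, verbatim)
    (hOp : ∀ k, c₁ / r₀ * 𝔖.rOp k ≤ ROp k) (hHist : ∀ k, (assembly 𝔖.toSlots).bHist E₀ cB k ≤ RHist k)
    (hHistA : ∀ k, (Gi * δI / (1 - ρ₁) + 2 * Gi / θ ^ k₁) * 𝔖.rHist k + EA₀ * (𝔖.rHist k * (cA / (1 - 𝔖.D.ω))) ≤ RHist k)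
    (hEA₀ : 0 ≤ EA₀) (hE₀ : 0 ≤ E₀) (hE₁ : 0 < E₁) (hcA : 0 ≤ cA) (hcB : 0 ≤ cB)
    (hc₁ : 0 ≤ c₁) (hr₀ : 0 < r₀) (hθ0 : 0 < θ) (hθθ' : θ ≤ θ') (hθ'1 : θ' ≤ 1) (hω : 0 < 𝔖.D.ω)
    (hω1 : 𝔖.D.ω < 1) (hreach : c₁ / r₀ * θ ^ k₀ ≤ ρ₀) (hB : 0 ≤ B) (hfirst : ∀ k < k₀, EA₀ + E₀ ≤ B * θ ^ k)
    (hsmall : 𝔖.D.ω + 2 * (Nbar * ((ε * Real.exp 64 * B12TreeDecay.K₀ (4 * 2 ^ 4) (2 * 4)) /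
          (1 - 36 * (ε * Real.exp 64 * B12TreeDecay.K₀ (4 * 2 ^ 4) (2 * 4))) ^ 2)) * cA < θ') :
    NE5 (outA 𝔖.toSlots E₀ cB) (outB 𝔖.toSlots E₀ cB) W ϰ θ'
      (((1 * ((εop * Real.exp 64 * B12TreeDecay.K₀ (4 * 2 ^ 4) (2 * 4)) /
          (1 - 36 * (εop * Real.exp 64 * B12TreeDecay.K₀ (4 * 2 ^ 4) (2 * 4))) ^ 2)) * (c₁ / r₀) +
          2 * (Nbar * ((ε * Real.exp 64 * B12TreeDecay.K₀ (4 * 2 ^ 4) (2 * 4)) /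
            (1 - 36 * (ε * Real.exp 64 * B12TreeDecay.K₀ (4 * 2 ^ 4) (2 * 4))) ^ 2)) * (Gi * δI / (1 - ρ₁) + 2 * Gi / θ ^ k₁) + B) *
          (θ' - 𝔖.D.ω) /
        (θ' - (𝔖.D.ω + 2 * (Nbar * ((ε * Real.exp 64 * B12TreeDecay.K₀ (4 * 2 ^ 4) (2 * 4)) /
          (1 - 36 * (ε * Real.exp 64 * B12TreeDecay.K₀ (4 * 2 ^ 4) (2 * 4))) ^ 2)) * cA))) :=
  ne5_of_record_secant_termwise 𝔖.toSlots E₀ cB rI hrI hT hbB hbA hdA hdB hRA hRB hwer hfl hienv hibdA hirate hδI hGi hρ₁ hreachI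
    (actOpBound_toSlots_of_refAt 𝔖 𝔡 E₀ cB hadm hgeo hlip hRefBase hρ₀1)
    (actOpLip_toSlots_of_refAt 𝔖 𝔡 E₀ cB hadm hgeo hlip hRefBase hρ₀1)
    (fun _ _ _ _ _ => zero_le_one) (fun _ _ _ _ _ => le_rfl) zero_le_one
    (fun _ _ _ Z ℓ => opMajorant_nonneg 𝔖 𝔡 hadm Z ℓ) hAop0' hdecop hεop h238op hΦopsmall
    (𝔖.actExpLinearOn_toSlots (refF_of_refAt _ _ _ _ _ 𝔡 hRef))
    (𝔖.actExpNormBound_toSlots E₀ cB (refF_of_refAt _ _ _ _ _ 𝔡 hRef))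
    (fun k _ _ Z ℓ => 𝔖.expModulus_nonneg k Z ℓ) (fun k _ _ Z ℓ => hNle k Z ℓ) hNbar0
    (𝔖.actAbsBound_toSlots (refF_of_refAt _ _ _ _ _ 𝔡 hRef)
      (fun k g hg U q hq X hX i hi m => invNorm_mul_integral_norm_F_le _ (hadm _ _) (hRef k g hg U q hq X hX i hi m)))
    (fun _ _ _ Z ℓ => size_nonneg (hadm Z ℓ)) hA0' hϰ hdec hε h238 hRt hΦsmall hOp hHist hHistA hEA₀ hE₀ hE₁ hcA hcB hc₁ hr₀ hθ0 hθθ'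
    hθ'1 hω hω1 hρ₀ hreach hB hfirst hsmall

end End


end Summit.QuantumFields.BalabanUV.T4Continuum.B13TermDataOpSecant

end
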